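import Summits.ResolutionOfSingularities.ResolutionOfSingularities.Theorems.FrobeniusClosingSteerCore4LowMultTwoCore
import Summits.ResolutionOfSingularities.ResolutionOfSingularities.Theorems.FrobeniusClosingSteerCore4IsoIsol
import Literature.AlgebraicGeometry.Resolution.QuadraticTransformsRegular
import Literature.AlgebraicGeometry.Resolution.ValuedFunctionFields
import Mathlib.FieldTheory.Perfect
import Mathlib.Algebra.CharP.Subring
import HarnessLib

/-!
# Crux `Steer` (stmt-16345), r9 residual R1 at `p = 2`: `core4LowMult_two` (the `p = 2` case of `Sig.stub_core4LowMult` is VACUOUS)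

OURS (campaign `res-hironaka`, rung L, slot W4.1, chain W4.1; replaces the role of no printed item; NOT a
statement of the manuscript under review). The registered frontier residual R1 `stub_core4LowMult` of
line `switching_dichotomy` r9 asks for `Concl` when the greedy torsor run STALLS at a stage `N` that is
neither steppable (`¬ CanStep`) nor of order one (`¬ OrderOneAt`) — cleaned order `ν ∈ [2, p-1]`. At `p = 2`
that interval is empty: this file PROVES the `p = 2` case of the registered statement (binders verbatim,
r9 vocabulary inlined, one extra hypothesis `p = 2`), by contradiction from the characteristic-2 core
`LowMult.canStep_or_orderOneAt_two` (p480796). Plumbing: the member `R N` of the quadratic sequence is regular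
local and dominated by `O` (`isRegularLocalRing_sequence`, `sequence_dominates`), has an exceptional parameter
(`LowMult.exists_isExcParam`), elements of positive value divide by it into `R (N+1)`
(`div_mem_of_isExcParam`, from `IsQuadraticTransformAlong.exists_eq_locAtCentre`), and its residue field is
perfect (algebraic over the perfect `k` by `ZeroDim`, `Algebra.IsAlgebraic.perfectField`), so every
element is a square modulo `𝔪`. No `Theses.*` / `Cruxes.*` import. [folklore]
-/

noncomputable section

-- layout-mandated namespace `Summit.<Summit>.<Problem>.…` with Summit = Problem (single-conjunct summit)
set_option linter.dupNamespace false

open IsLocalRing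
open Literature.AlgebraicGeometry.Resolution

namespace Summit.ResolutionOfSingularities.ResolutionOfSingularities.Theorems.SwitchingDichotomy.LowMult

variable {K : Type} [Field K]

/-! ### Division by an exceptional parameter lands in the quadratic transform -/

/-- **Q1 (light form).** Along a quadratic transform `R ⊂ R₁` of a subring dominated by `O`, every
element of positive value divided by ANY exceptional parameter `x` of `R` (an element of the centre of
maximal value) lies in `R₁`: `R₁ = (R[𝔪/x'])_{centre}` for some exceptional `x'`, `y/x' ∈ R[𝔪/x']`, and
`x'/x` is a unit of `R₁` since `v x = v x'`. [folklore] -/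
theorem div_mem_of_isExcParam (O : ValuationSubring K) {R R₁ : Subring K} [IsLocalRing R]
    (hQ : IsQuadraticTransformAlong O R R₁)
    (hdom : ∀ a : R, a ∈ maximalIdeal R ↔ O.valuation (a : K) < 1) {x : K}
    (hx : x ∈ R ∧ x ≠ 0 ∧ O.valuation x < 1 ∧ ∀ y ∈ R, O.valuation y < 1 → O.valuation y ≤ O.valuation x)
    {y : K} (hyR : y ∈ R) (hy : O.valuation y < 1) : y / x ∈ R₁ := by
  obtain ⟨_, x', hx'm, hx'0, hval, hR₁⟩ := hQ.exists_eq_locAtCentre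
  have hx'0K : (x' : K) ≠ 0 := fun h => hx'0 (Subtype.ext h)
  have hx'v : O.valuation (x' : K) < 1 := (hdom x').mp hx'm
  have hxx' : O.valuation x = O.valuation (x' : K) :=
    le_antisymm (hval ⟨x, hx.1⟩ ((hdom ⟨x, hx.1⟩).mpr hx.2.2.1)) (hx.2.2.2 _ x'.2 hx'v)
  -- `y / x'` and `x / x'` lie in the chart ring `R[𝔪/x']`
  have hmem : ∀ {z : K} (hz : z ∈ R), O.valuation z < 1 → z / (x' : K) ∈ blowupRing R (x' : K) :=
    fun {z} hz hv => Subring.subset_closure (Or.inr ⟨⟨z, hz⟩, (hdom ⟨z, hz⟩).mpr hv, rfl⟩)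
  have h1 : y / (x' : K) ∈ locAtCentre (blowupRing R (x' : K)) O := le_locAtCentre _ O (hmem hyR hy)
  have h2 : (x / (x' : K))⁻¹ ∈ locAtCentre (blowupRing R (x' : K)) O := by
    refine inv_mem_locAtCentre (le_locAtCentre _ O (hmem hx.1 hx.2.2.1)) ?_
    rw [map_div₀, hxx', div_self ((map_ne_zero O.valuation).mpr hx'0K)]
  have heq : y / x = y / (x' : K) * (x / (x' : K))⁻¹ := by
    rw [inv_div, div_mul_div_comm, mul_comm (x' : K) x, mul_div_mul_right _ _ hx'0K]
  rw [hR₁, heq]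
  exact Subring.mul_mem _ h1 h2

/-! ### Residue fields along the sequence: squares modulo `𝔪` -/

/-- **Every element of a member of the sequence is a square modulo its maximal ideal** (`p = 2`): for a
local subring `S ⊆ O` dominated by `O` and containing (the image of) a perfect field `k` of
characteristic `2` over which the residue field of `O` is algebraic (`ZeroDim`), the residue field of `S`
is perfect, so Frobenius is onto modulo `𝔪_S`. [folklore] -/
theorem exists_sub_sq_mem_maximalIdeal {k : Type} [Field k] [CharP k 2] [PerfectField k] [Algebra k K]
    (O : ValuationSubring K) (hzd : ∀ x ∈ O, ∃ f : Polynomial k, f ≠ 0 ∧ Polynomial.aeval x f ∈ O.nonunits)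
    (S : Subring K) [IsLocalRing S] (hSO : S ≤ O.toSubring)
    (hdom : ∀ a : S, a ∈ maximalIdeal S ↔ O.valuation (a : K) < 1)
    (hk : ∀ c : k, algebraMap k K c ∈ S) (f : S) : ∃ g : S, f - g ^ 2 ∈ maximalIdeal S := by
  haveI : Fact (Nat.Prime 2) := ⟨Nat.prime_two⟩
  haveI : CharP K 2 := charP_of_injective_algebraMap (algebraMap k K).injective 2
  -- `S` and its residue field as `k`-algebras
  let φk : k →+* S := (algebraMap k K).codRestrict S hk
  letI : Algebra k S := φk.toAlgebra
  letI : Algebra k (ResidueField S) := ((residue S).comp φk).toAlgebra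
  let resAlg : S →ₐ[k] ResidueField S := { residue S with commutes' := fun _ => rfl }
  let incl : S →ₐ[k] K := { S.subtype with commutes' := fun _ => rfl }
  -- the residue field is algebraic over `k`
  haveI : Algebra.IsAlgebraic k (ResidueField S) := by
    refine ⟨fun r => ?_⟩
    obtain ⟨a, rfl⟩ := residue_surjective r
    obtain ⟨P, hP0, hPa⟩ := hzd (a : K) (hSO a.2)
    refine ⟨P, hP0, ?_⟩
    have h1 : Polynomial.aeval (residue S a) P = residue S (Polynomial.aeval a P) :=
      Polynomial.aeval_algHom_apply resAlg a P
    have h2 : ((Polynomial.aeval a P : S) : K) = Polynomial.aeval (a : K) P :=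
      (Polynomial.aeval_algHom_apply incl a P).symm
    rw [h1, residue_eq_zero_iff, hdom, h2]
    exact (ValuationSubring.mem_nonunits_iff O).mp hPa
  haveI : PerfectField (ResidueField S) := Algebra.IsAlgebraic.perfectField k
  haveI : CharP (ResidueField S) 2 := Isol.charP_of_ringHom_of_prime 2 (residue S)
  haveI : ExpChar (ResidueField S) 2 := ExpChar.prime Nat.prime_two
  obtain ⟨gbar, hgbar⟩ := (bijective_frobenius (ResidueField S) 2).2 (residue S f)
  obtain ⟨g, rfl⟩ := residue_surjective gbar
  refine ⟨g, ?_⟩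
  rw [← residue_eq_zero_iff, map_sub, map_pow, ← hgbar, frobenius_def, sub_self]

/-! ### The `p = 2` case of the registered residual R1 -/

/-- **`core4LowMult_two`: the `p = 2` case of r9's frontier stub `Sig.stub_core4LowMult` holds (vacuously).**
Binders of the registered statement verbatim (r9 vocabulary `IsTorsorRunUpTo` / `CanStep` / `OrderOneAt` /
`Concl` inlined), with the one extra hypothesis `p = 2`: a stalled stage that is not of order one does not
exist in characteristic `2` (`LowMult.canStep_or_orderOneAt_two`). [folklore] -/
theorem core4LowMult_two :
    ∀ p : ℕ, p.Prime → p = 2 → ∀ n : ℕ, 4 ≤ n →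
    (∀ (k K : Type) [Field k] [CharP k p] [PerfectField k] [Field K] [Algebra k K]
      (O : ValuationSubring K) (A₀ : Subalgebra k K) (h₀ : A₀.toSubring ≤ O.toSubring) (t : K),
      Algebra.trdeg k K < (n : Cardinal) →
      (∀ x ∈ O, ∃ f : Polynomial k, f ≠ 0 ∧ Polynomial.aeval x f ∈ O.nonunits) →
      A₀.FG → t ^ p ∈ A₀ → IsFractionRing (Algebra.adjoin k (insert t (A₀ : Set K))) K →
      IsRegularLocalRing (Localization.AtPrime
        (Ideal.comap (Subring.inclusion h₀) (IsLocalRing.maximalIdeal O))) →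
      ∃ (A : Subalgebra k K) (h : A.toSubring ≤ O.toSubring), A₀ ≤ A ∧ t ∈ A ∧ A.FG ∧
        IsFractionRing A K ∧ IsRegularLocalRing (Localization.AtPrime
          (Ideal.comap (Subring.inclusion h) (IsLocalRing.maximalIdeal O)))) →
    ∀ (k K : Type) [Field k] [CharP k p] [PerfectField k] [Field K] [Algebra k K]
    (O : ValuationSubring K) (A₀ : Subalgebra k K) (h₀ : A₀.toSubring ≤ O.toSubring) (t : K),
    A₀.FG → ∀ (htp : t ^ p ∈ A₀), IsFractionRing (Algebra.adjoin k (insert t (A₀ : Set K))) K →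
    IsRegularLocalRing (Localization.AtPrime
      (Ideal.comap (Subring.inclusion h₀) (IsLocalRing.maximalIdeal O))) →
    (Ideal.comap (Subring.inclusion h₀) (IsLocalRing.maximalIdeal O)).IsMaximal →
    (∀ x ∈ O, ∃ f : Polynomial k, f ≠ 0 ∧ Polynomial.aeval x f ∈ O.nonunits) →
    ¬ ringKrullDim (Localization.AtPrime
      (Ideal.comap (Subring.inclusion h₀) (IsLocalRing.maximalIdeal O))) ≤ 2 →
    ¬ IsAbhyankarPlace O (algebraMap k K).fieldRange ⊤ →
    (¬ ∃ F₀ : Subfield K, (algebraMap k K).fieldRange ≤ F₀ ∧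
      FGOver (algebraMap k K).fieldRange F₀ ∧ IsAbhyankarPlace O (algebraMap k K).fieldRange F₀ ∧
      ∀ x w : K, w ≠ 0 → ∃ a ∈ F₀, O.valuation (x - a) < O.valuation w) →
    (¬ ∃ π : K, π ≠ 0 ∧ O.valuation π < 1 ∧
      ∀ z : K, z ≠ 0 → ∃ n : ℤ, O.valuation z = O.valuation π ^ n) →
    (∀ δ : Derivation ℤ (Localization.AtPrime (Ideal.comap (Subring.inclusion h₀)
        (IsLocalRing.maximalIdeal O))) (Localization.AtPrime (Ideal.comap (Subring.inclusion h₀)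
        (IsLocalRing.maximalIdeal O))),
      ¬ IsUnit (δ (algebraMap A₀.toSubring (Localization.AtPrime (Ideal.comap (Subring.inclusion h₀)
        (IsLocalRing.maximalIdeal O))) ⟨t ^ p, htp⟩))) →
    (∀ c : Localization.AtPrime (Ideal.comap (Subring.inclusion h₀) (IsLocalRing.maximalIdeal O)),
      algebraMap A₀.toSubring (Localization.AtPrime (Ideal.comap (Subring.inclusion h₀)
        (IsLocalRing.maximalIdeal O))) ⟨t ^ p, htp⟩ ≠ c ^ p) →
    Algebra.trdeg k K = (n : Cardinal) →
    ¬ ((∀ R : ℕ → Subring K, R 0 = locAtCentre A₀.toSubring O →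
          (∀ i, IsQuadraticTransformAlong O (R i) (R (i + 1))) →
          ∀ x : K, x ∈ O → (∃ y ∈ A₀, ∃ z ∈ A₀, z ≠ 0 ∧ x = y / z) → ∃ i, x ∈ R i) ∧
        (∀ R : ℕ → Subring K, R 0 = locAtCentre A₀.toSubring O →
          (∀ i, IsQuadraticTransformAlong O (R i) (R (i + 1))) →
          ∀ y : K, (∃ a ∈ A₀, ∃ b ∈ A₀, b ≠ 0 ∧ y = a / b) → y ≠ 0 → O.valuation y < 1 →
            ∃ (i : ℕ) (_ : IsLocalRing (R i)) (z : Fin 1 → R i), IsRsopPart z ∧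
              ∃ n : ℕ, O.valuation ((z 0 : R i) : K) ^ n < O.valuation y) ∧
        ¬ (∀ g : K, (∃ a ∈ A₀, ∃ b ∈ A₀, b ≠ 0 ∧ g = a / b) →
          ∃ w : K, (∃ a ∈ A₀, ∃ b ∈ A₀, b ≠ 0 ∧ w = a / b) ∧
            O.valuation (t ^ p - g ^ p) = O.valuation (w ^ p))) →
    ∀ R : ℕ → Subring K, R 0 = locAtCentre A₀.toSubring O →
      (∀ i, IsQuadraticTransformAlong O (R i) (R (i + 1))) →
      ∀ (s : ℕ → K) (N : ℕ),
        (s 0 = t ∧ (∀ i ≤ N, s i ^ p ∈ R i) ∧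
          ∀ i < N, ∃ x g : K, (x ∈ R i ∧ x ≠ 0 ∧ O.valuation x < 1 ∧
            ∀ y ∈ R i, O.valuation y < 1 → O.valuation y ≤ O.valuation x) ∧
            g ∈ R i ∧ s i = x * s (i + 1) + g) →
        ¬ (∃ s' : K, (∃ x g : K, (x ∈ R N ∧ x ≠ 0 ∧ O.valuation x < 1 ∧
            ∀ y ∈ R N, O.valuation y < 1 → O.valuation y ≤ O.valuation x) ∧
            g ∈ R N ∧ s N = x * s' + g) ∧ s' ^ p ∈ R (N + 1)) →
        ¬ (∃ g ∈ R N, ∃ (_ : IsLocalRing (R N)) (z : Fin 1 → R N), IsRsopPart z ∧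
            ((z 0 : R N) : K) = s N ^ p - g ^ p) →
        ∃ (A : Subalgebra k K) (h : A.toSubring ≤ O.toSubring), A₀ ≤ A ∧ t ∈ A ∧ A.FG ∧
          IsFractionRing A K ∧ IsRegularLocalRing (Localization.AtPrime
            (Ideal.comap (Subring.inclusion h) (IsLocalRing.maximalIdeal O))) := by
  intro p hp hp2 n hn ih k K _ _ _ _ _ O A₀ h₀ t hfg htp hfr hreg hmax hzd hdim2 hnA hnd hnD hδ hpow htr hnS
    R hR0 hRq s N hrun hnc hno
  subst hp2
  exfalso
  -- the member `R N`: regular local, dominated by `O`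
  haveI hreg0 : IsRegularLocalRing (R 0) := by
    rw [hR0]; exact (isRegularLocalRing_locAtCentre_iff h₀).mpr hreg
  have hdom0 : SubringDominates (R 0) O.toSubring := by
    rw [hR0]; exact subringDominates_locAtCentre h₀
  haveI : IsRegularLocalRing (R N) := isRegularLocalRing_sequence hreg0 hRq N
  have hdomN : SubringDominates (R N) O.toSubring := (sequence_dominates hdom0 hRq N).1
  have hRNO : R N ≤ O.toSubring := hdomN.1
  have hmaxN : ∀ a : R N, a ∈ maximalIdeal (R N) ↔ O.valuation (a : K) < 1 :=
    (subringDominates_valuationSubring_iff hRNO).mp hdomN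
  haveI : CharP K 2 := charP_of_injective_algebraMap (algebraMap k K).injective 2
  -- an exceptional parameter of `R N` (the maximal ideal is non-zero since the sequence continues)
  have hne : maximalIdeal (R N) ≠ ⊥ := by
    obtain ⟨_, x', hx'm, hx'0, -, -⟩ := (hRq N).exists_eq_locAtCentre
    intro h
    have : x' ∈ (⊥ : Ideal (R N)) := h ▸ hx'm
    exact hx'0 (Ideal.mem_bot.mp this)
  obtain ⟨x, hx⟩ := exists_isExcParam O (R N) hRNO hmaxN hne
  -- division by `x` lands in `R (N + 1)`
  have hdiv : ∀ y ∈ R N, O.valuation y < 1 → y / x ∈ R (N + 1) :=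
    fun y hy hv => div_mem_of_isExcParam O (hRq N) hmaxN hx hy hv
  -- squares modulo `𝔪`
  have hk : ∀ c : k, algebraMap k K c ∈ R N := fun c =>
    sequence_monotone hRq (Nat.zero_le N) (by rw [hR0]; exact le_locAtCentre _ O (A₀.algebraMap_mem c))
  have hperf := exists_sub_sq_mem_maximalIdeal O hzd (R N) hRNO hmaxN hk
  -- the stage steps or is of order one
  rcases canStep_or_orderOneAt_two O (R N) (R (N + 1)) hmaxN hperf x hx hdiv (s N) (hrun.2.1 N le_rfl)
    with hstep | hone
  · exact hnc hstep
  · exact hno hone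

end Summit.ResolutionOfSingularities.ResolutionOfSingularities.Theorems.SwitchingDichotomy.LowMult

end
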